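import Mathlib.GroupTheory.PresentedGroup
import Mathlib.Algebra.Group.Subgroup.Basic
import Mathlib.Algebra.Group.Subgroup.Ker
import Mathlib.Algebra.Group.End
import Literature.Topology.FourManifolds.GroupTrisections
import HarnessLib

/-!
# Stub `stub_conjOnClosure` of line `power-twist-absorption` for crux `CongruenceShadows.ShadowsStandard`
(item stmt-SmoothPoincare4-14593, route route-SmoothPoincare4-CongruenceShadows)

**Partial conjugation on generators extends to the generated subgroup.**  Let
`S_g = ⟨a₁,b₁,…,a_g,b_g ∣ ∏[aᵢ,bᵢ]⟩` be the surface group (`SurfaceGroup g`, generators indexed by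
`surfaceGen g = Fin g × Bool`), `T` an automorphism of `S_g`, `w ∈ S_g`, and `P` a predicate on the
generators.  If `T x = w x w⁻¹` for every standard generator `x` with `P x`, then `T s = w s w⁻¹` for
every `s` in the subgroup generated by those generators.

Proof: `T` and conjugation by `w` (`MulAut.conj w`) are two group homomorphisms `S_g → S_g` that
agree on the generating set `{x | P x}`; two homomorphisms agreeing on a set agree on its subgroup
closure (`MonoidHom.eqOn_closure`, i.e. the equaliser `{s | T s = w s w⁻¹}` is a subgroup).

In the line this is used with `P x := (x.1 < h)` and `w = w_h = ∏_{i<h}[aᵢ,bᵢ]`, the boundary word of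
the first `h` handles: the Dehn twist about the separating curve `δ_h` is the partial conjugation by
`w_h` on those handles, and since `w_h` lies in the subgroup they generate, `T w_h = w_h`.

This is the registered stub `stub_conjOnClosure` (STUB 2c) of the checked skeleton of the line.
Pure group theory over the tree's `SurfaceGroup`; no definitions, no named facts.
-/

-- the prescribed namespace `Summit.<P>.<Sub>.…` duplicates `SmoothPoincare4` (P = Sub)
set_option linter.dupNamespace false

open Literature.Topology.FourManifolds Subgroup

namespace Summit.SmoothPoincare4.SmoothPoincare4.Theorems.ShadowsStandard.PowerTwistAbsorption

/-- **STUB 2c · `stub_conjOnClosure`** (absorption piece, def-free, any genus): if an automorphism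
`T` of the surface group `S_g` acts as conjugation by `w` on every standard generator satisfying `P`,
then it acts as conjugation by `w` on the whole subgroup those generators generate.  (Two
homomorphisms — `T` and `MulAut.conj w` — that agree on a set agree on its subgroup closure.)
[folklore] -/
theorem stub_conjOnClosure :
    ∀ (g : ℕ) (P : surfaceGen g → Prop) (w : SurfaceGroup g) (T : SurfaceGroup g ≃* SurfaceGroup g),
      (∀ x : surfaceGen g, P x → T (PresentedGroup.of x) = w * PresentedGroup.of x * w⁻¹) →
      ∀ s ∈ Subgroup.closure
          ((fun x : surfaceGen g => (PresentedGroup.of x : SurfaceGroup g)) '' {x | P x}),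
        T s = w * s * w⁻¹ := by
  intro g P w T hT s hs
  -- `T` and conjugation by `w` agree on the generating set …
  have key : Set.EqOn T.toMonoidHom (MulAut.conj w).toMonoidHom
      ((fun x : surfaceGen g => (PresentedGroup.of x : SurfaceGroup g)) '' {x | P x}) := by
    rintro _ ⟨x, hx, rfl⟩
    simpa only [MulEquiv.coe_toMonoidHom, MulAut.conj_apply] using hT x hx
  -- … hence on its subgroup closure.
  simpa only [MulEquiv.coe_toMonoidHom, MulAut.conj_apply] using MonoidHom.eqOn_closure key hs

end Summit.SmoothPoincare4.SmoothPoincare4.Theorems.ShadowsStandard.PowerTwistAbsorption
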